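import Summits.Ventures.CertifiedManyBodySolver.Rows.RectMarginalNodesTW
import HarnessLib

/-!
# Square-lattice window-marginal nodes — module 6/9: RectMarginalNodesSym

HONEST FRAMING: first certified bounds; not a superconductivity verdict; every number certified or labelled float.
SOUNDNESS / TRANSPORT statements only (inequalities between relaxations and finite-torus / thermodynamic-limit energies); no number is certified here.
THIS module: §7 header, 7.1 the density matrix of a functional (`densityOfFun`, `trace_densityOfFun_mul`, …), 7.2 the symmetric row families `WindowP4m` / `WindowSpinFlip` / `WindowSU2` and the nodes `LTIRectSymNode` / `LTIRectSymGSNode` / `LTIRectSymGSNodeTW` (+ `.mono`, weakenings), `spinPlus_commutator_fermionEmbed`, `WindowLTI.wfun_meanEnergyObs`.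

FILING NOTE (sr-mbsolver-lit-4 g9, 2026-08-22): modules 5–9 `Rows/RectMarginalNodesTW.lean` → `…Sym.lean` → `…SymTorus.lean` → `…SymTransport.lean` → `…SymTL.lean`
continue parts 1–4 (`Rows/RectMarginalNodes.lean` … `Rows/RectMarginalNodesGS.lean`) and are sr-mbsolver-op-07 gen-12's PROVED HOME file
`HOME/sr-mbsolver-op-07/lean/RectMarginalNodes_v3.2.lean` (sha256 d4d4026ae96b32c5…, 2 279 lines, sorry-free, standard axioms; = v3.1 87fe4cef… with the §7.4 proof cut into
`IsSymTorusState` / `isSymTorusState_sectorGround` / `le_div_of_isSymTorusState`) §6b–§7 split per op-07's `FILING-MAP-v3.2.md` (one-writer rule; §8 not filed: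
content-duplicate of pub-hubbard #235 `HubbardAlg/GSWindowNodeD4Sound.lean`), namespace `…CertifiedManyBodySolver.Sketch2D` renamed `Summit.Ventures.CertifiedManyBodySolver.Rows.RectMarginalNodes`;
declarations, statements and proofs VERBATIM (9 one-line docstrings added for the gate's lint; modules 8/9 re-declare the §7.3 `variable {L : ℕ} [NeZero L]` and module 8
re-applies module 7's `DecidableEq (FermionTorus 2 L)` instance as a local instance of priority high (op-07 g13 advisories A1/A2 adopted: minimal imports, no pin in module 9).
-/

noncomputable section

open Matrix Complex Finset Filter Topology
open scoped ComplexOrder MatrixOrder BigOperators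
open Literature.Probability.LatticeModels
open Literature.MathematicalPhysics.QuantumLattice
open Literature.MathematicalPhysics.QuantumLattice.AndersonCluster
open Literature.MathematicalPhysics.QuantumLattice.HubbardWave0
open Literature.MathematicalPhysics.QuantumLattice.ThermodynamicLimit
open Literature.MathematicalPhysics.QuantumManyBody.StateRelaxation

namespace Summit.Ventures.CertifiedManyBodySolver.Rows.RectMarginalNodes

section SymNodes

/-! ## §7  The SYMMETRIC nodes `LTIRectSymNode` / `LTIRectSymGSNode` (LTI + `U(1)×U(1)` block + `S^z` + spin-flip +
`SU(2)` + `p4m` space-group [+ local-stability] rows) and their BY-VALUE transport through the tracial ground state of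
the `N`-particle sector of the `L × L` torus (discharges G-SYM-2D, G-ISO, G-SU2 of v1) -/


/-! ### 7.1  The density matrix of a linear functional on a window algebra -/

/-- The density matrix of a linear functional `φ` on `𝔄_Λ`: `(ρ_φ)_{s u} = φ(|u⟩⟨s|)`, so that `Tr(ρ_φ A) = φ(A)`. -/
def densityOfFun {Λ : Finset (Site 2)} (φ : FermionOp Λ →ₗ[ℂ] ℂ) : FermionOp Λ :=
  fun s u => φ (Matrix.single u s 1)

/-- Entries of the density matrix of a functional (definitional unfolding). -/
theorem densityOfFun_apply {Λ : Finset (Site 2)} (φ : FermionOp Λ →ₗ[ℂ] ℂ) (s u : Finset (Orb (PolySite Λ))) :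
    densityOfFun φ s u = φ (Matrix.single u s 1) := rfl

/-- `Tr(ρ_φ A) = φ(A)`. -/
theorem trace_densityOfFun_mul {Λ : Finset (Site 2)} (φ : FermionOp Λ →ₗ[ℂ] ℂ) (A : FermionOp Λ) :
    (densityOfFun φ * A).trace = φ A := by
  conv_rhs => rw [Matrix.matrix_eq_sum_single A, map_sum]
  simp only [map_sum]
  rw [Matrix.trace]
  simp only [Matrix.diag_apply, Matrix.mul_apply, densityOfFun_apply]
  rw [Finset.sum_comm]
  refine Finset.sum_congr rfl fun s _ => Finset.sum_congr rfl fun t _ => ?_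
  rw [mul_comm, ← smul_eq_mul, ← map_smul, Matrix.smul_single, smul_eq_mul, mul_one]

/-- `ρ_φ` is Hermitian for a Hermitian functional. -/
theorem densityOfFun_isHermitian {Λ : Finset (Site 2)} (φ : FermionOp Λ →ₗ[ℂ] ℂ) (hφ : ∀ A, φ Aᴴ = star (φ A)) :
    (densityOfFun φ).IsHermitian := by
  ext s u
  rw [Matrix.conjTranspose_apply, densityOfFun_apply, densityOfFun_apply, ← hφ]
  congr 1
  ext x y
  rw [Matrix.conjTranspose_apply, Matrix.single_apply, Matrix.single_apply]
  by_cases h : s = y ∧ u = x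
  · rw [if_pos h, if_pos ⟨h.2, h.1⟩, star_one]
  · rw [if_neg h, if_neg (fun h' => h ⟨h'.2, h'.1⟩), star_zero]

/-- `ρ_φ ⪰ 0` for a positive Hermitian functional: `x̄ᵀ ρ_φ x = φ(Cᴴ C)`, `C = Σ_s conj(x_s) |∅⟩⟨s|`. -/
theorem densityOfFun_posSemidef {Λ : Finset (Site 2)} (φ : FermionOp Λ →ₗ[ℂ] ℂ) (hφ : ∀ A, φ Aᴴ = star (φ A))
    (hpos : ∀ C, 0 ≤ φ (Cᴴ * C)) : (densityOfFun φ).PosSemidef := by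
  refine Matrix.PosSemidef.of_dotProduct_mulVec_nonneg (densityOfFun_isHermitian φ hφ) fun x => ?_
  set C : FermionOp Λ := ∑ s, star (x s) • Matrix.single ∅ s (1 : ℂ) with hC
  have hCC : Cᴴ * C = ∑ s, ∑ t, (star (x s) * x t) • Matrix.single t s (1 : ℂ) := by
    simp only [hC, Matrix.conjTranspose_sum, Matrix.conjTranspose_smul, Matrix.conjTranspose_single,
      star_star, star_one, Finset.sum_mul, Finset.mul_sum, Matrix.smul_mul, Matrix.mul_smul,
      Matrix.single_mul_single_same, smul_smul, mul_one]
  have hq : star x ⬝ᵥ (densityOfFun φ *ᵥ x) = φ (Cᴴ * C) := by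
    rw [hCC, map_sum]
    simp only [map_sum, map_smul, smul_eq_mul, dotProduct, Matrix.mulVec, Pi.star_apply,
      Finset.mul_sum, densityOfFun_apply]
    refine Finset.sum_congr rfl fun s _ => Finset.sum_congr rfl fun t _ => ?_
    ring
  rw [hq]
  exact hpos C

/-! ### 7.2  The `p4m` rows, the symmetric node, the mean-energy bookkeeping on a window-LTI matrix -/

/-- **Space-group (`p4m = ℤ² ⋊ D₄`) rows** of a window matrix `ρ` on `W`: for every sub-region `S ⊆ W` and every affine
point-group map `x ↦ γ x + w` with `γ S + w ⊆ W`, the marginal on `S` and the one on `γ S + w` pulled back along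
`Γ(d4Emb γ w S)` agree as functionals on `𝔄_S`.  (The D₄-IDENTIFICATION rows of `tl_marginal2d` / the
`G`-identification of Form-M; with `γ = 1` these are the LTI rows again, with `γ = r` (rotation) and `S` a bond they
contain the x/y-ISOTROPY row `G-ISO`.) -/
def WindowP4m {W : Finset (Site 2)} (ρ : FermionOp W) : Prop :=
  ∀ (γ : DihedralGroup 4) (w : Site 2) (S : Finset (Site 2)) (hS : S ⊆ W) (hS' : d4ShiftSet γ w S ⊆ W)
    (A : FermionOp S),
    (ρ * fermionEmbed (PolySite.incl hS) A).trace =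
      (ρ * fermionEmbed ((PolySite.d4Emb γ w S).trans (PolySite.incl hS')) A).trace

/-- **Spin-flip rows** of a window matrix: `Tr ρ Γ_swap(A) = Tr ρ A` for the spin-exchange Bogoliubov automorphism
`Γ_swap = relabel Orb.spinSwap` (`c_{xσ} ↦ c_{x,σ̄}`) of `𝔄_W` (the `ℤ₂^{flip}` identification rows of `tl_marginal2d` /
Form-M). -/
def WindowSpinFlip {W : Finset (Site 2)} (ρ : FermionOp W) : Prop :=
  ∀ A : FermionOp W, (ρ * relabel (Orb.spinSwap : Orb (PolySite W) ≃ Orb (PolySite W)) A).trace = (ρ * A).trace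

/-- **`SU(2)`-commutant rows** of a window matrix: `Tr ρ [S⁺_W, A] = 0` for all `A`, `S⁺_W = Σ_{y ∈ W} c†_{y↑} c_{y↓}`
(equivalently `[ρ, S⁺_W] = 0`, and then also `[ρ, S⁻_W] = 0` for Hermitian `ρ`): the optional `su2_rows` of
`tl_marginal2d` / the `SU(2)` reduction of Form-M (lever L2 "spin SU(2)"). -/
def WindowSU2 {W : Finset (Site 2)} (ρ : FermionOp W) : Prop :=
  ∀ A : FermionOp W, (ρ * ((spinPlus : FermionOp W) * A - A * spinPlus)).trace = 0

/-- **The symmetric LTI rectangle node** `LTIRectSymNode t U a b n lo`: rows = {PSD, trace, LTI (all sub-regions /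
shifts), density, spin-resolved densities `Tr ρ N_{W,σ} = a b n / 2`, `U(1)×U(1)` BLOCK rows
`Tr ρ [N_{W,σ}, A] = 0` for all `A` (equivalently: `ρ` commutes with `N_{W,↑}` and `N_{W,↓}`, i.e. is block-diagonal
in the joint particle-number sectors of the window), spin-flip rows (`WindowSpinFlip`), `SU(2)`-commutant rows
(`WindowSU2`), `p4m` rows (`WindowP4m`)} `⇒ lo ≤ Re Tr ρ h_avg`.  This is the FULL row set of `tl_marginal2d` at
`n ≠ 1` (LTI + `D₄ × ℤ₂^{flip}` identification + `U(1)²` blocks + isotropy + `su2_rows`) and of Form-M's `G × SU(2)`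
reduction; only the half-filling particle–hole rows (bipartite, `n = 1`, `t' = 0`; not used at the target `n = 7/8`)
are not modelled. -/
def LTIRectSymNode (t U : ℝ) (a b : ℕ) (n lo : ℝ) : Prop :=
  ∀ ρ : FermionOp (rectWindow a b), ρ.PosSemidef → ρ.trace = 1 → WindowLTI ρ →
    ((ρ * totalNumber).trace).re = ((a : ℝ) * b) * n →
    (∀ σ : Fin 2, ((ρ * ∑ y : PolySite (rectWindow a b), numberOp y σ).trace).re = ((a : ℝ) * b) * (n / 2)) →
    (∀ (σ : Fin 2) (A : FermionOp (rectWindow a b)),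
      (ρ * ((∑ y : PolySite (rectWindow a b), numberOp y σ) * A -
        A * ∑ y : PolySite (rectWindow a b), numberOp y σ)).trace = 0) →
    WindowSpinFlip ρ → WindowSU2 ρ → WindowP4m ρ →
    lo ≤ ((ρ * hAvg t U a b).trace).re

/-- Monotonicity of the symmetric node in its bound. -/
theorem LTIRectSymNode.mono {t U : ℝ} {a b : ℕ} {n lo lo' : ℝ} (h : LTIRectSymNode t U a b n lo) (hlo : lo' ≤ lo) :
    LTIRectSymNode t U a b n lo' :=
  fun ρ h1 h2 h3 h4 h5 h6 h7 h8 h9 => hlo.trans (h ρ h1 h2 h3 h4 h5 h6 h7 h8 h9)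

/-- Dropping rows: an `LTIRectNode` bound is an `LTIRectSymNode` bound. -/
theorem LTIRectNode.symNode {t U : ℝ} {a b : ℕ} {n lo : ℝ} (h : LTIRectNode t U a b n lo) :
    LTIRectSymNode t U a b n lo :=
  fun ρ h1 h2 h3 h4 _ _ _ _ _ => h ρ h1 h2 h3 h4

/-- **The symmetric ground-state-class node** `LTIRectSymGSNode t U a b n lo`: ALL rows of `LTIRectSymNode` PLUS the
Bratteli–Robinson LOCAL-STABILITY ("EOM / KKT", lever L4) rows `0 ≤ Tr ρ Γ(Λ⁺ ↪ W)(Ãᴴ [H_{Λ⁺}, Ã])` for every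
region `Λ` with `Λ⁺ = thicken Λ 1 ⊆ W` and every local `A ∈ 𝔄_Λ` conserving the local particle number (NO `S^z`
condition — more rows than §6's `LTIRectGSNode`).  The union of the row sets of §4, §6 and §7; its soundness
(`LTIRectSymGSNode.le_energyDensity2D`) is what licenses using symmetry rows AND stability rows in ONE programme. -/
def LTIRectSymGSNode (t U : ℝ) (a b : ℕ) (n lo : ℝ) : Prop :=
  ∀ ρ : FermionOp (rectWindow a b), ρ.PosSemidef → ρ.trace = 1 → WindowLTI ρ →
    ((ρ * totalNumber).trace).re = ((a : ℝ) * b) * n →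
    (∀ σ : Fin 2, ((ρ * ∑ y : PolySite (rectWindow a b), numberOp y σ).trace).re = ((a : ℝ) * b) * (n / 2)) →
    (∀ (σ : Fin 2) (A : FermionOp (rectWindow a b)),
      (ρ * ((∑ y : PolySite (rectWindow a b), numberOp y σ) * A -
        A * ∑ y : PolySite (rectWindow a b), numberOp y σ)).trace = 0) →
    WindowSpinFlip ρ → WindowSU2 ρ → WindowP4m ρ →
    (∀ (Λ : Finset (Site 2)) (hΛ : thicken Λ 1 ⊆ rectWindow a b) (A : FermionOp Λ), Commute A totalNumber →
        0 ≤ (ρ * fermionEmbed (PolySite.incl hΛ) (stabilityObs t U Λ A)).trace) →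
    lo ≤ ((ρ * hAvg t U a b).trace).re

/-- Monotonicity of the symmetric ground-state-class node in its bound. -/
theorem LTIRectSymGSNode.mono {t U : ℝ} {a b : ℕ} {n lo lo' : ℝ} (h : LTIRectSymGSNode t U a b n lo)
    (hlo : lo' ≤ lo) : LTIRectSymGSNode t U a b n lo' :=
  fun ρ h1 h2 h3 h4 h5 h6 h7 h8 h9 h10 => hlo.trans (h ρ h1 h2 h3 h4 h5 h6 h7 h8 h9 h10)

/-- Dropping the stability rows. -/
theorem LTIRectSymNode.symGSNode {t U : ℝ} {a b : ℕ} {n lo : ℝ} (h : LTIRectSymNode t U a b n lo) :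
    LTIRectSymGSNode t U a b n lo :=
  fun ρ h1 h2 h3 h4 h5 h6 h7 h8 h9 _ => h ρ h1 h2 h3 h4 h5 h6 h7 h8 h9

/-- Dropping the symmetry rows (and the stability rows for `A` not commuting with `S^z_Λ`): an `LTIRectGSNode` bound
is an `LTIRectSymGSNode` bound. -/
theorem LTIRectGSNode.symGSNode {t U : ℝ} {a b : ℕ} {n lo : ℝ} (h : LTIRectGSNode t U a b n lo) :
    LTIRectSymGSNode t U a b n lo :=
  fun ρ h1 h2 h3 h4 h5 _ _ _ _ hst => h ρ h1 h2 h3 h4 h5 fun Λ hΛ A hN _ => hst Λ hΛ A hN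

/-- **The symmetric node WITH term-wise-relocated stability rows** (§6b): all rows of `LTIRectSymGSNode` plus, for
every box `Λ ⊆ W` and every `A ∈ 𝔄_Λ` commuting with `N_Λ`, the relocated rows `0 ≤ D.row ρ` of every translation
datum `D : TWDatum` AND of every affine-`D₄` datum `D : TWDatumD4` — l2-idea-1's `M3⁺(W)` object (M3PLUS-SPEC §1–§4)
together with L1's WLOG symmetry rows.  By-value transport: `LTIRectSymGSNodeTW.le_groundEnergyAt_div`. -/
def LTIRectSymGSNodeTW (t U : ℝ) (a b : ℕ) (n lo : ℝ) : Prop :=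
  ∀ ρ : FermionOp (rectWindow a b), ρ.PosSemidef → ρ.trace = 1 → WindowLTI ρ →
    ((ρ * totalNumber).trace).re = ((a : ℝ) * b) * n →
    (∀ σ : Fin 2, ((ρ * ∑ y : PolySite (rectWindow a b), numberOp y σ).trace).re = ((a : ℝ) * b) * (n / 2)) →
    (∀ (σ : Fin 2) (A : FermionOp (rectWindow a b)),
      (ρ * ((∑ y : PolySite (rectWindow a b), numberOp y σ) * A -
        A * ∑ y : PolySite (rectWindow a b), numberOp y σ)).trace = 0) →
    WindowSpinFlip ρ → WindowSU2 ρ → WindowP4m ρ →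
    (∀ (Λ : Finset (Site 2)) (hΛ : thicken Λ 1 ⊆ rectWindow a b) (A : FermionOp Λ), Commute A totalNumber →
        0 ≤ (ρ * fermionEmbed (PolySite.incl hΛ) (stabilityObs t U Λ A)).trace) →
    (∀ Λ : Finset (Site 2), Λ ⊆ rectWindow a b → ∀ A : FermionOp Λ, Commute A totalNumber →
        ∀ D : TWDatum t U (rectWindow a b) Λ A, 0 ≤ D.row ρ) →
    (∀ Λ : Finset (Site 2), Λ ⊆ rectWindow a b → ∀ A : FermionOp Λ, Commute A totalNumber →
        ∀ D : TWDatumD4 t U (rectWindow a b) Λ A, 0 ≤ D.row ρ) →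
    lo ≤ ((ρ * hAvg t U a b).trace).re

/-- Monotonicity of the symmetric term-wise ground-state-class node in its bound. -/
theorem LTIRectSymGSNodeTW.mono {t U : ℝ} {a b : ℕ} {n lo lo' : ℝ} (h : LTIRectSymGSNodeTW t U a b n lo)
    (hlo : lo' ≤ lo) : LTIRectSymGSNodeTW t U a b n lo' :=
  fun ρ h1 h2 h3 h4 h5 h6 h7 h8 h9 h10 h11 h12 => hlo.trans (h ρ h1 h2 h3 h4 h5 h6 h7 h8 h9 h10 h11 h12)

/-- Dropping the term-wise rows: an `LTIRectSymGSNode` bound is an `LTIRectSymGSNodeTW` bound. -/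
theorem LTIRectSymGSNode.tw {t U : ℝ} {a b : ℕ} {n lo : ℝ} (h : LTIRectSymGSNode t U a b n lo) :
    LTIRectSymGSNodeTW t U a b n lo :=
  fun ρ h1 h2 h3 h4 h5 h6 h7 h8 h9 h10 _ _ => h ρ h1 h2 h3 h4 h5 h6 h7 h8 h9 h10


/-- **`[S⁺, Γ_φ(a)] = Γ_φ([S⁺, a])`**: the spin-raising operator of `Λ'` is the embedded one of `Λ` plus the terms
`c†_{y↑} c_{y↓}` over sites OUTSIDE the range of `φ`, which are even and hence commute with `Γ_φ(𝔄_Λ)` (graded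
locality; the `S⁺`-analogue of `Transport.sum_numberOp_commutator_fermionEmbed`). -/
theorem spinPlus_commutator_fermionEmbed {Λ Λ' : Type*} [LinearOrder Λ] [Fintype Λ] [LinearOrder Λ'] [Fintype Λ']
    (φ : Λ ↪ Λ') (a : Matrix (Finset (Orb Λ)) (Finset (Orb Λ)) ℂ) :
    (spinPlus : Matrix (Finset (Orb Λ')) (Finset (Orb Λ')) ℂ) * fermionEmbed φ a - fermionEmbed φ a * spinPlus =
      fermionEmbed φ (spinPlus * a - a * spinPlus) := by
  classical
  -- the terms outside the range commute with the embedded algebra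
  have hout : ∀ y : Λ', y ∉ Set.range φ →
      (creation (orb y 0) * annihilation (orb y 1) : Matrix (Finset (Orb Λ')) (Finset (Orb Λ')) ℂ) * fermionEmbed φ a =
        fermionEmbed φ a * (creation (orb y 0) * annihilation (orb y 1)) := by
    intro y hy
    refine (commute_fermionEmbed_of_mem_carEvenSubalgebra φ a (S := orbs ({y} : Finset Λ'))
      (creation_mul_annihilation_mem_carEvenSubalgebra (orb_mem_orbs.2 (Finset.mem_singleton_self y))
        (orb_mem_orbs.2 (Finset.mem_singleton_self y))) ?_).eq
    rw [Finset.disjoint_left]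
    intro i hi hi'
    have h1 : (ofLex i).1 = y := Finset.mem_singleton.1 (mem_orbs.1 hi)
    obtain ⟨x, -, hx⟩ := Finset.mem_map.1 (mem_orbs.1 hi')
    exact hy ⟨x, hx.trans h1⟩
  -- split `S⁺` of `Λ'` along the range of `φ`
  have hsplit : (spinPlus : Matrix (Finset (Orb Λ')) (Finset (Orb Λ')) ℂ) =
      fermionEmbed φ spinPlus +
        ∑ y ∈ (Finset.univ : Finset Λ').filter (fun y => y ∉ Set.range φ), creation (orb y 0) * annihilation (orb y 1) := by
    simp only [spinPlus, map_sum, map_mul, fermionEmbed_creation, fermionEmbed_annihilation]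
    rw [← Finset.sum_map Finset.univ φ
        (fun y => (creation (orb y 0) * annihilation (orb y 1) : Matrix (Finset (Orb Λ')) (Finset (Orb Λ')) ℂ)),
      ← Finset.sum_filter_add_sum_filter_not Finset.univ (fun y : Λ' => y ∈ Set.range φ)]
    congr 1
    refine Finset.sum_congr ?_ fun _ _ => rfl
    ext y
    simp only [Finset.mem_filter, Finset.mem_univ, true_and, Finset.mem_map, Set.mem_range]
  have hR : (∑ y ∈ (Finset.univ : Finset Λ').filter (fun y => y ∉ Set.range φ),
      (creation (orb y 0) * annihilation (orb y 1) : Matrix (Finset (Orb Λ')) (Finset (Orb Λ')) ℂ)) * fermionEmbed φ a =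
      fermionEmbed φ a * ∑ y ∈ (Finset.univ : Finset Λ').filter (fun y => y ∉ Set.range φ),
        creation (orb y 0) * annihilation (orb y 1) := by
    rw [Finset.sum_mul, Finset.mul_sum]
    refine Finset.sum_congr rfl fun y hy => ?_
    exact hout y (Finset.mem_filter.1 hy).2
  rw [hsplit, add_mul, mul_add, hR, map_sub, map_mul, map_mul]
  abel

/-- **The mean-energy observable on a window-LTI matrix**: if `[-1,1]² ⊆ W`, then
`Tr ρ Γ(E_Φ) = Tr ρ Φ{0} + Σ_i Tr ρ Φ{0,e_i}` (the two half bonds through the origin in direction `i` have the same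
value by LTI; matrix-level twin of `IsTranslationInvariant.expect_hubbard_meanEnergyObs`). -/
theorem WindowLTI.wfun_meanEnergyObs {W : Finset (Site 2)} {ρ : FermionOp W} (hρ : WindowLTI ρ) (t U : ℝ)
    (hth : thicken ({0} : Finset (Site 2)) 1 ⊆ W) (hW : ∀ i : Fin 2, ({0, 0 + unitVec i} : Finset (Site 2)) ⊆ W) :
    wfun ρ hth ((hubbardFermionInteraction 2 t U).meanEnergyObs 1) = wSite ρ t U hW + ∑ i : Fin 2, wBond ρ t U hW i := by
  have H := congrArg (wfun ρ hth) (hubbardFermionInteraction_meanEnergyObs (d := 2) (t := t) (U := U))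
  rw [map_add] at H
  rw [map_sum] at H
  refine H.trans ?_
  have h0 : wfun ρ hth (fermionEmbed (PolySite.incl (singleton_subset_iff.2 (zero_mem_thicken_zero 1)))
      ((hubbardFermionInteraction 2 t U).Φ {0})) = wSite ρ t U hW :=
    wfun_fermionEmbed_incl ρ _ hth _
  rw [h0, add_right_inj]
  refine Finset.sum_congr rfl fun i _ => ?_
  have h1 : wfun ρ hth (fermionEmbed (PolySite.incl (pair_unitVec_subset_thicken_one i))
      ((hubbardFermionInteraction 2 t U).Φ {0, 0 + unitVec i})) = wBond ρ t U hW i :=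
    wfun_fermionEmbed_incl ρ _ hth _
  have h2 : wfun ρ hth (fermionEmbed (PolySite.incl (pair_neg_unitVec_subset_thicken_one i))
      ((hubbardFermionInteraction 2 t U).Φ {-unitVec i, -unitVec i + unitVec i})) = wBond ρ t U hW i := by
    rw [wfun_fermionEmbed_incl]
    exact hρ.wfun_pair t U (-unitVec i) i ((pair_neg_unitVec_subset_thicken_one i).trans hth) (hW i)
  rw [map_add, map_smul, map_smul, h1, h2, ← add_smul]
  norm_num

end SymNodes

end Summit.Ventures.CertifiedManyBodySolver.Rows.RectMarginalNodes

end
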